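import Literature.Probability.LatticeModels.RegularScales
import HarnessLib

/-!
# All-direction unit-step gradient bounds for the two-point function from the axis gradient
estimate (route MirrorHoelderCompactness, helper for item stmt-CriticalPhenomena-6151 `SeparableHoelder`)

For the nearest-neighbour Ising model on `ℤ^d` with `β ≥ 0` and `m*(β) = 0` (so in particular at
`β = β_c` for `d ≥ 3`), write `S = twoPointFree d β` and `g_i(n) = S(n e_i)` (independent of the
axis `i`). The tree's axis gradient estimate `twoPointFree_gradient_estimate`
(Duminil-Copin–Panis 2025, eq. (1.11); Aizenman–Duminil-Copin 2021, Prop. 5.9) controls the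
steps `S(w) - S(w + e_i)` ALONG a large coordinate `w_i`; the Messager–Miracle-Solé inequality
"applied twice" (ADC 2021, proof of Prop. 5.9) transfers it to steps in EVERY lattice direction at
points of large sup-norm. This file is the `d`-dimensional, `g(4q)`-referenced version of the
`d = 4` lemmas `dcp_step`, `two_sided_step`, `step_bound_of_nonneg`, `step_bound` of
`Literature/Probability/LatticeModels/RegularScales.lean` (where the reference value is a box
susceptibility instead), followed by the path corollary (`abs_sub_le_mul_l1Dist_of_steps`) and two
elementary lemmas on doubling sequences used to compare `g` at comparable scales.

* `dcp_step'` : `0 ≤ S(w) - S(w + e_i) ≤ g(4q)/(4q+1)` when `w_i ≥ 8q`;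
* `two_sided_step'`, `step_bound_of_nonneg'`, `step_bound'` : `|S(z + e_i) - S(z)| ≤ g(4q)/(4q+1)`
  for every direction `i` as soon as `‖z‖_∞ ≥ 16q` (`q ≥ 1`);
* `abs_sub_le_ref_mul_l1Dist` : `|S(x) - S(y)| ≤ g(4q)/(4q+1) · ‖x - y‖₁` when
  `16q + ‖x - y‖_∞ ≤ ‖x‖_∞`;
* `le_inv_pow_mul_of_doubling`, `le_inv_pow_mul_of_doubling_of_le` : `g(t) ≤ κ^{-J} g(2^J t)` and
  `g(t) ≤ κ^{-J} g(N)` for `N ≤ 2^J t`, for an antitone doubling sequence.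

References: M. Aizenman, H. Duminil-Copin, Ann. of Math. 194 (2021), arXiv:1912.07973, Prop. 5.9 and
proof of Thm. 5.12; H. Duminil-Copin, R. Panis, Comm. Math. Phys. 406 (2025), arXiv:2404.05700,
eq. (1.11); A. Messager, S. Miracle-Solé, J. Stat. Phys. 17 (1977). No definitions are introduced.
-/

noncomputable section

open Filter Finset
open scoped BigOperators

namespace Summit.CriticalPhenomena.Ising3DConformalLimit.MirrorHoelderCompactnessSeparableHoelder

open Literature.Probability.LatticeModels

variable {d : ℕ} {β : ℝ}

/-! ### One step along a large coordinate -/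

/-- **One gradient step along a large coordinate** (`twoPointFree_gradient_estimate` with `j = 4q`):
for `m*(β) = 0` and `w_i ≥ 8q`, `0 ≤ S(w) - S(w + e_i) ≤ g(4q)/(4q+1)`, `g(4q) = S(4q e_{i₀})` along
any axis `i₀`. [cite: AizenmanDuminilCopinAnnals2021, arXiv:1912.07973 Proposition 5.9] -/
theorem dcp_step' (hβ : 0 ≤ β) (hm0 : spontaneousMagnetization d β = 0) (q : ℕ) (i₀ : Fin d)
    {w : Site d} {i : Fin d} (hwi : ((8 * q : ℕ) : ℤ) ≤ w i) :
    0 ≤ twoPointFree d β w - twoPointFree d β (w + Pi.single i 1) ∧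
      twoPointFree d β w - twoPointFree d β (w + Pi.single i 1) ≤
        twoPointFree d β (Pi.single i₀ ((4 * q : ℕ) : ℤ)) / (4 * (q : ℝ) + 1) := by
  constructor
  · have h := messager_miracleSole_free hβ w i (by omega)
    linarith
  · have hdcp := twoPointFree_gradient_estimate hβ hm0 i w (4 * q) (by push_cast; omega)
    refine hdcp.trans ?_
    rw [twoPointFree_single_eq_single hβ i i₀]
    have hden : (4 * (q : ℝ) + 1) ≤ (w i : ℝ) - 4 * (q : ℝ) + 1 := by
      have : ((8 * q : ℕ) : ℝ) ≤ (w i : ℝ) := by exact_mod_cast hwi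
      push_cast at this
      linarith
    have hden0 : (0 : ℝ) < 4 * (q : ℝ) + 1 := by positivity
    have hnum0 : 0 ≤ twoPointFree d β (Pi.single i₀ ((4 * q : ℕ) : ℤ)) :=
      twoPointFree_nonneg_of_nonneg hβ _
    push_cast
    exact div_le_div_of_nonneg_left hnum0 hden0 hden

/-- **Two-sided control of a step in a small coordinate** (Messager–Miracle-Solé applied twice,
ADC 2021, proof of Prop. 5.9, case `i ≠ 1`): if `0 ≤ w_i`, `w_i + 1 ≤ w_{i₁}` for another index
`i₁` with `w_{i₁} - 1 ≥ 8q`, then `|S(w + e_i) - S(w)| ≤ g(4q)/(4q+1)`.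
[cite: AizenmanDuminilCopinAnnals2021, arXiv:1912.07973 proof of Proposition 5.9 (p. 19)] -/
theorem two_sided_step' (hβ : 0 ≤ β) (hm0 : spontaneousMagnetization d β = 0) (q : ℕ) (i₀ : Fin d)
    {w : Site d} {i i₁ : Fin d} (hii : i₁ ≠ i) (hwi : 0 ≤ w i) (hwi' : w i + 1 ≤ w i₁)
    (hbig : ((8 * q : ℕ) : ℤ) ≤ w i₁ - 1) :
    |twoPointFree d β (w + Pi.single i 1) - twoPointFree d β w| ≤
      twoPointFree d β (Pi.single i₀ ((4 * q : ℕ) : ℤ)) / (4 * (q : ℝ) + 1) := by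
  set S := twoPointFree d β with hS
  -- a1: `S(w + e_{i₁}) ≤ S(w + eᵢ)`
  have a1 : S (w + Pi.single i₁ 1) ≤ S (w + Pi.single i 1) := by
    have h := messager_miracleSole_diag_free hβ (w + Pi.single i 1) hii (by simp [hii]; omega)
    have heq : w + Pi.single i 1 + Pi.single i₁ 1 - Pi.single i 1 = w + Pi.single i₁ 1 := by abel
    rw [heq] at h
    exact h
  -- a2: `S(w + eᵢ) ≤ S(w - e_{i₁})` (reflect the `i`-th coordinate)
  have a2 : S (w + Pi.single i 1) ≤ S (w - Pi.single i₁ 1) := by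
    set u : Site d := Function.update w i (-w i) - Pi.single i₁ 1 with hu
    have hui : u i = -w i := by simp [hu, hii]
    have hui₁ : u i₁ = w i₁ - 1 := by simp [hu, hii]
    have h := messager_miracleSole_diag_free hβ u hii (by rw [hui, hui₁]; omega)
    have heq1 : u + Pi.single i₁ 1 - Pi.single i 1 =
        Function.update (w + Pi.single i 1) i (-(w + Pi.single i 1 : Site d) i) := by
      funext j
      simp only [hu, Pi.add_apply, Pi.sub_apply, Site.update_neg_apply]
      by_cases hj : j = i
      · subst hj; simp [Ne.symm hii]; ring
      · by_cases hj' : j = i₁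
        · subst hj'; simp [hj]
        · simp [hj, hj']
    have heq2 : u = Function.update (w - Pi.single i₁ 1) i (-(w - Pi.single i₁ 1 : Site d) i) := by
      funext j
      simp only [hu, Pi.sub_apply, Site.update_neg_apply]
      by_cases hj : j = i
      · subst hj; simp [Ne.symm hii]
      · simp [hj]
    rw [heq1, twoPointFree_reflection hβ, heq2, twoPointFree_reflection hβ] at h
    exact h
  -- a3: axis monotonicity at `w` and `w - e_{i₁}`
  have hw0 : 0 ≤ w i₁ := by omega
  have a3 : S (w + Pi.single i₁ 1) ≤ S w := messager_miracleSole_free hβ w i₁ hw0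
  have a3' : S w ≤ S (w - Pi.single i₁ 1) := by
    have h := messager_miracleSole_free hβ (w - Pi.single i₁ 1) i₁ (by simp; omega)
    rw [sub_add_cancel] at h
    exact h
  -- a4: two gradient steps along `i₁`
  have d1 := (dcp_step' hβ hm0 q i₀ (w := w) (i := i₁) (by omega)).2
  have d2' := dcp_step' hβ hm0 q i₀ (w := w - Pi.single i₁ 1) (i := i₁) (by simp; omega)
  rw [sub_add_cancel] at d2'
  have d2 := d2'.2
  rw [abs_le]
  constructor <;> linarith

/-- **The single-step bound at points with a non-negative step coordinate**: for `q ≥ 1`,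
`m*(β) = 0`, every `w` with `‖w‖_∞ ≥ 16q - 1` and `w_i ≥ 0` satisfies `|S(w + e_i) - S(w)| ≤ g(4q)/(4q+1)`.
[cite: AizenmanDuminilCopinAnnals2021, arXiv:1912.07973 proof of Proposition 5.9 and of Theorem 5.12 (P2)] -/
theorem step_bound_of_nonneg' (hβ : 0 ≤ β) (hm0 : spontaneousMagnetization d β = 0) {q : ℕ}
    (hq : 1 ≤ q) (i₀ : Fin d) {w : Site d} (hw : 16 * q - 1 ≤ Site.supNorm w) {i : Fin d}
    (hwi : 0 ≤ w i) :
    |twoPointFree d β (w + Pi.single i 1) - twoPointFree d β w| ≤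
      twoPointFree d β (Pi.single i₀ ((4 * q : ℕ) : ℤ)) / (4 * (q : ℝ) + 1) := by
  by_cases hlarge : ((8 * q : ℕ) : ℤ) ≤ w i
  · obtain ⟨h0, h1⟩ := dcp_step' hβ hm0 q i₀ (w := w) (i := i) hlarge
    rw [abs_sub_comm, abs_of_nonneg h0]
    exact h1
  · push Not at hlarge
    obtain ⟨i₁, hi₁⟩ := Site.exists_natAbs_eq_supNorm ⟨i, Finset.mem_univ _⟩ w
    have hbig : 8 * q + 2 ≤ (w i₁).natAbs := by rw [hi₁]; omega
    have hii : i₁ ≠ i := by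
      rintro rfl
      omega
    rcases lt_or_gt_of_ne (show w i₁ ≠ 0 by omega) with hneg | hposw
    · -- reflect the `i₁`-th coordinate
      set w' : Site d := Function.update w i₁ (-w i₁) with hw'
      have hw'i₁ : w' i₁ = -w i₁ := by simp [hw']
      have hw'i : w' i = w i := by simp [hw', Ne.symm hii]
      have h := two_sided_step' hβ hm0 q i₀ (w := w') hii (by rw [hw'i]; exact hwi)
        (by rw [hw'i, hw'i₁]; omega) (by rw [hw'i₁]; omega)
      have heq1 : w' + Pi.single i 1 =
          Function.update (w + Pi.single i 1) i₁ (-(w + Pi.single i 1 : Site d) i₁) := by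
        funext j
        simp only [hw', Pi.add_apply, Site.update_neg_apply]
        by_cases hj : j = i₁
        · subst hj; simp [hii]
        · simp [hj]
      rw [heq1, twoPointFree_reflection hβ, hw', twoPointFree_reflection hβ] at h
      exact h
    · exact two_sided_step' hβ hm0 q i₀ hii hwi (by omega) (by omega)

/-- **The single-step bound in every direction** (`q ≥ 1`, `m*(β) = 0`): for every `z` with
`‖z‖_∞ ≥ 16q` and every direction `i`, `|S(z + e_i) - S(z)| ≤ g(4q)/(4q+1)` (if `z_i < 0`, reflect
the `i`-th coordinate of `z + e_i`). [cite: AizenmanDuminilCopinAnnals2021, arXiv:1912.07973 proof of Theorem 5.12 (P2, p. 20)] -/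
theorem step_bound' (hβ : 0 ≤ β) (hm0 : spontaneousMagnetization d β = 0) {q : ℕ} (hq : 1 ≤ q)
    (i₀ : Fin d) {z : Site d} (hz : 16 * q ≤ Site.supNorm z) (i : Fin d) :
    |twoPointFree d β (z + Pi.single i 1) - twoPointFree d β z| ≤
      twoPointFree d β (Pi.single i₀ ((4 * q : ℕ) : ℤ)) / (4 * (q : ℝ) + 1) := by
  rcases le_or_gt 0 (z i) with hzi | hzi
  · exact step_bound_of_nonneg' hβ hm0 hq i₀ (by omega) hzi
  · set w : Site d := Function.update (z + Pi.single i 1) i (-(z + Pi.single i 1 : Site d) i) with hw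
    have hwi : 0 ≤ w i := by simp [hw]; omega
    have hnorm : 16 * q - 1 ≤ Site.supNorm w := by
      rw [hw, Site.supNorm_update_neg]
      have h1 := Site.supNorm_le_supNorm_sub_add z (z + Pi.single i 1)
      have h2 : Site.supNorm (z - (z + Pi.single i 1)) ≤ 1 := by
        rw [sub_add_cancel_left, Site.supNorm_neg]
        exact Site.supNorm_single_one_le i
      omega
    have h := step_bound_of_nonneg' hβ hm0 hq i₀ hnorm hwi
    have heq : w + Pi.single i 1 = Function.update z i (-z i) := by
      funext j
      simp only [hw, Pi.add_apply, Site.update_neg_apply]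
      by_cases hj : j = i
      · subst hj; simp
      · simp [hj]
    rw [heq, twoPointFree_reflection hβ, hw, twoPointFree_reflection hβ, abs_sub_comm] at h
    exact h

/-! ### The path corollary -/

/-- **Increments at large sup-norm**: if `16q + ‖x - y‖_∞ ≤ ‖x‖_∞` (`q ≥ 1`, `m*(β) = 0`) then
`|S(x) - S(y)| ≤ g(4q)/(4q+1) · ‖x - y‖₁` — every point of the coordinate hull of `x, y` has
sup-norm at least `16q`, so the path lemma `abs_sub_le_mul_l1Dist_of_steps` applies with the
single-step bound `step_bound'`. [cite: AizenmanDuminilCopinAnnals2021, arXiv:1912.07973 proof of Theorem 5.12 (P2, p. 20)] -/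
theorem abs_sub_le_ref_mul_l1Dist (hβ : 0 ≤ β) (hm0 : spontaneousMagnetization d β = 0) {q : ℕ}
    (hq : 1 ≤ q) (i₀ : Fin d) {x y : Site d} (hx : 16 * q + Site.supNorm (x - y) ≤ Site.supNorm x) :
    |twoPointFree d β x - twoPointFree d β y| ≤
      twoPointFree d β (Pi.single i₀ ((4 * q : ℕ) : ℤ)) / (4 * (q : ℝ) + 1) * Site.l1Dist x y := by
  refine abs_sub_le_mul_l1Dist_of_steps (T := {z : Site d | 16 * q ≤ Site.supNorm z})
    (fun z hz i => step_bound' hβ hm0 hq i₀ hz i) (Site.l1Dist x y) x y rfl fun z hz => ?_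
  show 16 * q ≤ Site.supNorm z
  have h1 : Site.supNorm (z - x) ≤ Site.supNorm (x - y) := Site.supNorm_sub_le_of_inHull hz
  have h2 := Site.supNorm_le_supNorm_sub_add x z
  rw [Site.supNorm_sub_comm] at h2
  omega

/-! ### Doubling sequences -/

/-- Iterated doubling, lower form: from `κ g(t) ≤ g(2t)` (`t ≥ 1`, `κ > 0`) follows
`g(t) ≤ κ^{-J} g(2^J t)`. [folklore] -/
theorem le_inv_pow_mul_of_doubling {g : ℕ → ℝ} {κ : ℝ} (hκ : 0 < κ)
    (hdouble : ∀ t : ℕ, 1 ≤ t → κ * g t ≤ g (2 * t)) (J : ℕ) {t : ℕ} (ht : 1 ≤ t) :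
    g t ≤ κ⁻¹ ^ J * g (2 ^ J * t) := by
  induction J with
  | zero => simp
  | succ J ih =>
      have h1 : 1 ≤ 2 ^ J * t :=
        Nat.one_le_iff_ne_zero.2 (Nat.mul_ne_zero (pow_ne_zero _ two_ne_zero) (by omega))
      have h2 : g (2 ^ J * t) ≤ κ⁻¹ * g (2 ^ (J + 1) * t) := by
        have h := hdouble _ h1
        rw [show 2 * (2 ^ J * t) = 2 ^ (J + 1) * t by rw [pow_succ]; ring] at h
        rw [le_inv_mul_iff₀ hκ]
        exact h
      calc g t ≤ κ⁻¹ ^ J * g (2 ^ J * t) := ih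
        _ ≤ κ⁻¹ ^ J * (κ⁻¹ * g (2 ^ (J + 1) * t)) :=
            mul_le_mul_of_nonneg_left h2 (pow_nonneg (inv_nonneg.2 hκ.le) J)
        _ = κ⁻¹ ^ (J + 1) * g (2 ^ (J + 1) * t) := by rw [pow_succ]; ring

/-- Comparison at comparable scales: for an antitone (on the positive integers) doubling sequence,
`g(t) ≤ κ^{-J} g(N)` whenever `1 ≤ t` and `N ≤ 2^J t`. [folklore] -/
theorem le_inv_pow_mul_of_doubling_of_le {g : ℕ → ℝ} {κ : ℝ} (hκ : 0 < κ)
    (hdouble : ∀ t : ℕ, 1 ≤ t → κ * g t ≤ g (2 * t))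
    (hanti : ∀ a b : ℕ, 1 ≤ a → a ≤ b → g b ≤ g a) (J : ℕ) {t N : ℕ} (ht : 1 ≤ t) (hN1 : 1 ≤ N)
    (hN : N ≤ 2 ^ J * t) :
    g t ≤ κ⁻¹ ^ J * g N :=
  (le_inv_pow_mul_of_doubling hκ hdouble J ht).trans
    (mul_le_mul_of_nonneg_left (hanti N _ hN1 hN) (pow_nonneg (inv_nonneg.2 hκ.le) J))

end Summit.CriticalPhenomena.Ising3DConformalLimit.MirrorHoelderCompactnessSeparableHoelder

end
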